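import Summits.RiemannHypothesis.RiemannHypothesis.Theorems.WeilFormatCOscTailAbel
import Summits.RiemannHypothesis.RiemannHypothesis.Theorems.WeilFormatCTrigTailSums
import HarnessLib

/-!
# Format C, design C∞: the iterated-Abel boxes for `Σ cos(mφ)/m^s`, `Σ sin(mφ)/m^s` (real form for the kit)

Route context: Fourier–Galerkin / Schur-complement certificates of Weil positivity on a window ("format C", design C∞;
cell memo `run/shared/lean/pub/rh-explicit/rh-explicit-weil-2/gen9/CINF-DOOR-SIZING.md` §9–§10, item E1; supporting
stmt-RiemannHypothesis-0098; seat rh-explicit-weil-2).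

`WeilFormatCOscTailAbel.norm_oscTail_inv_pow_sub_abel_le` boxes the complex tail `Σ'_k z^{m₀+k}/(m₀+k)^s` (`z = e^{iφ}`).  The
family-Gram entries of `WeilFormatCFamilyGram` are the REAL sums `Σ'_k cos((m₀+k)φ)/(m₀+k)^s` and `Σ'_k sin((m₀+k)φ)/(m₀+k)^s`; this
file takes real and imaginary parts and rewrites `‖1 − e^{iφ}‖ = 2|sin(φ/2)|`:

* `hasSum_cos_div_pow`, `hasSum_sin_div_pow` — the real sums are the real/imaginary parts of the complex tail;
* `abs_tsum_cos_div_pow_sub_le`, `abs_tsum_sin_div_pow_sub_le` — for `sin(φ/2) ≠ 0`, `2 ≤ s`, `1 ≤ m₀`, `1 ≤ K`: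
  `|Σ' cos((m₀+k)φ)/(m₀+k)^s − Re MAIN| ≤ |Δ^{K−1}(1/n^s)(m₀)| / (2|sin(φ/2)|)^K` (and `sin` with `Im MAIN`),
  `MAIN = (Σ_{j<K} (z/(1−z))^j (Δ^j(1/n^s))(m₀)) z^{m₀}/(1−z)`, `z = e^{iφ}`.

Elementary; standard axioms; no definitions; no RH claim.
-/

-- `Summit.RiemannHypothesis.RiemannHypothesis.…` is the layout-mandated namespace (summit = problem name).
set_option linter.dupNamespace false

noncomputable section

open Filter Set fwdDiff Complex
open scoped Topology

namespace Summit.RiemannHypothesis.RiemannHypothesis.Theorems.WeilFormatC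

/-- `(e^{iφ})^n` has real part `cos(nφ)` and imaginary part `sin(nφ)`. -/
theorem cexp_I_mul_pow_re_im (φ : ℝ) (n : ℕ) :
    ((Complex.exp (I * φ)) ^ n).re = Real.cos (n * φ) ∧ ((Complex.exp (I * φ)) ^ n).im = Real.sin (n * φ) := by
  rw [← Complex.exp_nat_mul, show (n : ℂ) * (I * φ) = ((n * φ : ℝ) : ℂ) * I by push_cast; ring]
  exact ⟨Complex.exp_ofReal_mul_I_re _, Complex.exp_ofReal_mul_I_im _⟩

/-- `‖e^{iφ}‖ = 1`. -/
theorem norm_cexp_I_mul (φ : ℝ) : ‖Complex.exp (I * φ)‖ = 1 := by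
  rw [mul_comm]; exact Complex.norm_exp_ofReal_mul_I φ

/-- `‖1 − e^{iφ}‖ = 2|sin(φ/2)|`. -/
theorem norm_one_sub_cexp_I_mul (φ : ℝ) : ‖1 - Complex.exp (I * φ)‖ = 2 * |Real.sin (φ / 2)| := by
  rw [norm_sub_rev, Complex.norm_exp_I_mul_ofReal_sub_one, Real.norm_eq_abs, abs_mul, abs_of_pos (by norm_num : (0:ℝ) < 2)]

/-- Summability and `HasSum` of the twisted power tail with `z = e^{iφ}` (`2 ≤ s`). -/
theorem hasSum_cexp_pow_div_pow (φ : ℝ) {s : ℕ} (hs : 2 ≤ s) (m₀ : ℕ) :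
    HasSum (fun k ↦ (((1 / (((m₀ + k : ℕ)) : ℝ) ^ s : ℝ)) : ℂ) * (Complex.exp (I * φ)) ^ (m₀ + k))
      (∑' k, (((1 / (((m₀ + k : ℕ)) : ℝ) ^ s : ℝ)) : ℂ) * (Complex.exp (I * φ)) ^ (m₀ + k)) := by
  refine (summable_shift_mul_pow (norm_cexp_I_mul φ) (v := fun n : ℕ ↦ (((1 / (n : ℝ) ^ s : ℝ)) : ℂ)) (m₀ := m₀) ?_).hasSum
  have h := Real.summable_one_div_nat_pow.mpr (by omega : 1 < s)
  have h2 := (summable_nat_add_iff m₀).2 h.norm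
  refine h2.congr fun k ↦ ?_
  simp only [Complex.norm_real, Nat.cast_add, add_comm]

/-- The real cosine tail is the real part of the complex tail. -/
theorem hasSum_cos_div_pow (φ : ℝ) {s : ℕ} (hs : 2 ≤ s) (m₀ : ℕ) :
    HasSum (fun k ↦ Real.cos ((m₀ + k : ℕ) * φ) / (((m₀ + k : ℕ)) : ℝ) ^ s)
      (∑' k, (((1 / (((m₀ + k : ℕ)) : ℝ) ^ s : ℝ)) : ℂ) * (Complex.exp (I * φ)) ^ (m₀ + k)).re := by
  have h := (hasSum_cexp_pow_div_pow φ hs m₀).mapL Complex.reCLM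
  refine h.congr_fun fun k ↦ ?_
  simp only [Complex.reCLM_apply, Complex.re_ofReal_mul, (cexp_I_mul_pow_re_im φ (m₀ + k)).1]
  rw [Nat.cast_add]; ring

/-- The real sine tail is the imaginary part of the complex tail. -/
theorem hasSum_sin_div_pow (φ : ℝ) {s : ℕ} (hs : 2 ≤ s) (m₀ : ℕ) :
    HasSum (fun k ↦ Real.sin ((m₀ + k : ℕ) * φ) / (((m₀ + k : ℕ)) : ℝ) ^ s)
      (∑' k, (((1 / (((m₀ + k : ℕ)) : ℝ) ^ s : ℝ)) : ℂ) * (Complex.exp (I * φ)) ^ (m₀ + k)).im := by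
  have h := (hasSum_cexp_pow_div_pow φ hs m₀).mapL Complex.imCLM
  refine h.congr_fun fun k ↦ ?_
  simp only [Complex.imCLM_apply, Complex.im_ofReal_mul, (cexp_I_mul_pow_re_im φ (m₀ + k)).2]
  rw [Nat.cast_add]; ring

/-- **Cosine tail box**: for `sin(φ/2) ≠ 0`, `2 ≤ s`, `1 ≤ m₀`, `1 ≤ K`, `z = e^{iφ}`, `u(n) = 1/n^s`:
`|Σ'_k cos((m₀+k)φ)/(m₀+k)^s − Re((Σ_{j<K} (z/(1−z))^j (Δ^j u)(m₀)) z^{m₀}/(1−z))| ≤ |(Δ^{K−1} u)(m₀)| / (2|sin(φ/2)|)^K`. -/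
theorem abs_tsum_cos_div_pow_sub_le {φ : ℝ} (hφ : Real.sin (φ / 2) ≠ 0) {s : ℕ} (hs : 2 ≤ s) {m₀ : ℕ} (hm₀ : 1 ≤ m₀)
    {K : ℕ} (hK : 1 ≤ K) :
    |(∑' k, Real.cos ((m₀ + k : ℕ) * φ) / (((m₀ + k : ℕ)) : ℝ) ^ s)
        - ((∑ j ∈ Finset.range K, (Complex.exp (I * φ) / (1 - Complex.exp (I * φ))) ^ j *
            (((((Δ_[1])^[j] (fun n : ℕ ↦ 1 / (n : ℝ) ^ s)) m₀ : ℝ)) : ℂ)) * (Complex.exp (I * φ)) ^ m₀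
            / (1 - Complex.exp (I * φ))).re|
      ≤ |((Δ_[1])^[K - 1] (fun n : ℕ ↦ 1 / (n : ℝ) ^ s)) m₀| / (2 * |Real.sin (φ / 2)|) ^ K := by
  have hz1 : Complex.exp (I * φ) ≠ 1 := cexp_mul_I_ne_one hφ
  have h := norm_oscTail_inv_pow_sub_abel_le (norm_cexp_I_mul φ) hz1 hs hm₀ hK
  rw [norm_one_sub_cexp_I_mul] at h
  rw [(hasSum_cos_div_pow φ hs m₀).tsum_eq, ← Complex.sub_re]
  exact (Complex.abs_re_le_norm _).trans h

/-- **Sine tail box** (same hypotheses, imaginary part). -/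
theorem abs_tsum_sin_div_pow_sub_le {φ : ℝ} (hφ : Real.sin (φ / 2) ≠ 0) {s : ℕ} (hs : 2 ≤ s) {m₀ : ℕ} (hm₀ : 1 ≤ m₀)
    {K : ℕ} (hK : 1 ≤ K) :
    |(∑' k, Real.sin ((m₀ + k : ℕ) * φ) / (((m₀ + k : ℕ)) : ℝ) ^ s)
        - ((∑ j ∈ Finset.range K, (Complex.exp (I * φ) / (1 - Complex.exp (I * φ))) ^ j *
            (((((Δ_[1])^[j] (fun n : ℕ ↦ 1 / (n : ℝ) ^ s)) m₀ : ℝ)) : ℂ)) * (Complex.exp (I * φ)) ^ m₀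
            / (1 - Complex.exp (I * φ))).im|
      ≤ |((Δ_[1])^[K - 1] (fun n : ℕ ↦ 1 / (n : ℝ) ^ s)) m₀| / (2 * |Real.sin (φ / 2)|) ^ K := by
  have hz1 : Complex.exp (I * φ) ≠ 1 := cexp_mul_I_ne_one hφ
  have h := norm_oscTail_inv_pow_sub_abel_le (norm_cexp_I_mul φ) hz1 hs hm₀ hK
  rw [norm_one_sub_cexp_I_mul] at h
  rw [(hasSum_sin_div_pow φ hs m₀).tsum_eq, ← Complex.sub_im]
  exact (Complex.abs_im_le_norm _).trans h

end Summit.RiemannHypothesis.RiemannHypothesis.Theorems.WeilFormatC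

end
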